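import Summits.MatrixMultiplication.MatrixMultiplication.Theorems.FarEdgeDescentAnchorLaw
import Mathlib.Analysis.Convex.Mul
import HarnessLib

/-!
# Route `FarEdgeDescent` — THE HARMONIC WORLD: a lawful pencil `(2x+1)²/(4x)` with plateau `[0,½]`, value `9/4`,
# in which EVERY anchored law `L(a)`, `a ≥ ½`, holds and the special leaf fails
(lens-2 «special vs generic», gen 42; support module for the crux `AnchoredLogConvexity`
stmt-MatrixMultiplication-28900; companion of `FarEdgeDescentAnchorLaw` §2; def-free; cut of record UNCHANGED)

`FarEdgeDescentAnchorLaw.not_anchoredLaw_of_finiteSaturation` refutes every sub-square anchored law `L(a)`,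
`a < 1`, FROM THE SPECIAL LEAF, and `anchoredLaw_false_of_lt_alpha` refutes `L(a)` for `a < α` outright.  Left
open there (memo U10): is `L(a)` for `α ≤ a < 1` refutable from the shape laws alone?  **No**:

* `harmonicWorld` — the profile `f(x) = 2 (x ≤ ½)`, `f(x) = x + 1 + 1/(4x) = (2x+1)²/(4x) (x ≥ ½)` is an
  ADMISSIBLE PENCIL WITH THE FOLD (convex, monotone, 1-Lipschitz, `max(2,x+1) ≤ f ≤ x+2`, and
  `(1+y)·f(2/(1+y)) ≤ 2·f(y)` — the fold reduces on `[½,3]` to `(y−1)²(y−4) ≤ 0`), hence by the landed pencil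
  realisability theorem (`FarEdgeDescentPencilRealisability.perspectiveWorld_realises`) the pencil of a
  functional `W` with ALL the 3D laws.  Its data: plateau exactly `[0,½]` (dual exponent `½`), `W(1,1,1) = 9/4`,
  excess `e_W(x) = 1/(4x)` on `[½,∞)` — positive everywhere, so NO length is saturated (the special leaf fails in
  `W` at every `K`), and `e_W(m)² ≤ e_W(a)·e_W(2m−a) ⟺ a(2m−a) ≤ m²`: **`L_W(a)` holds for every anchor
  `a ≥ ½`** — all of `[α_W, 1)`, the square anchor `a = 1` (`AnchoredLogConvexity`-shape) and beyond — and
  fails for every `0 < a < ½` (plateau anchors, as in `anchoredLaw_false_of_lt_alpha`): in `W` the truth set of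
  the anchored family is exactly `[α_W, ∞)`, while `ω_W = 9/4 > 2`.
* Consequences (`harmonicWorld_reading`): (i) the special-leaf hypothesis of `not_anchoredLaw_of_finiteSaturation`
  cannot be traded for the shape laws plus a plateau — sub-square anchors at or above the dual exponent are
  refutable ONLY relative to the special leaf; (ii) a rational, plateau-carrying companion of the lineage's
  exponential world for «the generic leaf alone does not give `ω = 2`» (`AnchoredLogConvexity`-shape,
  `RealLogConvexity`-shape and `SmoothProfile`-shape all hold in `W`); (iii) the cut of record is untouched:
  `W` violates `FiniteSaturation`-shape, exactly the leaf `closes` pairs with the generic law.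

[cite: HuangPan1998, §2 eq. (2.5)–(2.8)] [cite: Coppersmith1997, §1] [cite: LottiRomani1983, §2 (p. 174)]
-/

set_option linter.dupNamespace false

noncomputable section

namespace Summit.MatrixMultiplication.MatrixMultiplication.Theorems.FarEdgeDescentHarmonicWorld

open Literature.Computability.AlgebraicComplexity Set
open Summit.MatrixMultiplication.MatrixMultiplication.Theses.FarEdgeDescent
open Summit.MatrixMultiplication.MatrixMultiplication.Theorems.FarEdgeDescentPencilRealisability

/-! ## §1 The harmonic profile is an admissible pencil with the fold -/

/-- `g(t) = t + 1 + 1/(4t)` is monotone and 1-Lipschitz on `[½,∞)`:  `0 ≤ g(t) − g(s) ≤ t − s`. -/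
theorem harmonic_incr {s t : ℝ} (hs : 1 / 2 ≤ s) (hst : s ≤ t) :
    0 ≤ (t + 1 + 1 / (4 * t)) - (s + 1 + 1 / (4 * s)) ∧
      (t + 1 + 1 / (4 * t)) - (s + 1 + 1 / (4 * s)) ≤ t - s := by
  have hs0 : 0 < s := by linarith
  have ht0 : 0 < t := by linarith
  have hdiff : 1 / (4 * s) - 1 / (4 * t) = (t - s) / (4 * s * t) := by
    field_simp
  have h1 : 1 / (4 * t) ≤ 1 / (4 * s) := one_div_le_one_div_of_le (by linarith) (by linarith)
  have h2 : (t - s) / (4 * s * t) ≤ t - s := div_le_self (by linarith) (by nlinarith)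
  constructor <;> linarith

/-- `g(t) − 2 = (2t−1)²/(4t) ≥ 0` and `g(t) > t + 1` (`t > 0`). -/
theorem harmonic_floor {t : ℝ} (ht : 0 < t) : 2 ≤ t + 1 + 1 / (4 * t) ∧ t + 1 < t + 1 + 1 / (4 * t) := by
  have h1 : t + 1 + 1 / (4 * t) - 2 = (2 * t - 1) ^ 2 / (4 * t) := by field_simp; ring
  have h2 : 0 ≤ (2 * t - 1) ^ 2 / (4 * t) := by positivity
  have h3 : 0 < 1 / (4 * t) := by positivity
  constructor <;> linarith

/-- `g` is convex on `[½,∞)` (`t ↦ t⁻¹` is convex on `(0,∞)`). -/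
theorem harmonic_convexOn : ConvexOn ℝ (Ici (1 / 2 : ℝ)) (fun t : ℝ => t + 1 + 1 / (4 * t)) := by
  have hinv : ConvexOn ℝ (Ioi (0 : ℝ)) (fun x : ℝ => x⁻¹) := by
    simpa [zpow_neg, zpow_one] using (convexOn_zpow (-1) : ConvexOn ℝ (Ioi (0 : ℝ)) fun x : ℝ => x ^ (-1 : ℤ))
  have h1 : ConvexOn ℝ (Ioi (0 : ℝ)) (fun t : ℝ => t + 1 + (1 / 4 : ℝ) • t⁻¹) :=
    ((convexOn_id (convex_Ioi (0 : ℝ))).add (convexOn_const (1 : ℝ) (convex_Ioi (0 : ℝ)))).add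
      (hinv.smul (by norm_num))
  have h2 : ConvexOn ℝ (Ici (1 / 2 : ℝ)) (fun t : ℝ => t + 1 + (1 / 4 : ℝ) • t⁻¹) :=
    h1.subset (fun t (ht : 1 / 2 ≤ t) => show (0 : ℝ) < t by linarith) (convex_Ici _)
  refine h2.congr fun t ht => ?_
  have ht0 : (t : ℝ) ≠ 0 := ne_of_gt (lt_of_lt_of_le (by norm_num) (show (1 / 2 : ℝ) ≤ t from ht))
  simp only [smul_eq_mul]
  field_simp

/-- The image of `[0,∞)` under `x ↦ max x ½` is `[½,∞)`. -/
theorem image_max_half : (fun x : ℝ => max x (1 / 2)) '' Ici (0 : ℝ) = Ici (1 / 2 : ℝ) := by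
  ext y
  constructor
  · rintro ⟨x, -, rfl⟩
    show (1 / 2 : ℝ) ≤ max x (1 / 2)
    exact le_max_right _ _
  · intro (hy : 1 / 2 ≤ y)
    exact ⟨y, show (0 : ℝ) ≤ y by linarith, max_eq_left hy⟩

/-- **Admissibility of the harmonic profile** `f(x) = max(x,½) + 1 + 1/(4·max(x,½))`: convex, monotone,
1-Lipschitz, floors, ceiling — and the FOLD for every `y > 0`. -/
theorem harmonic_admissible :
    ConvexOn ℝ (Ici 0) (fun x : ℝ => max x (1 / 2) + 1 + 1 / (4 * max x (1 / 2))) ∧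
    MonotoneOn (fun x : ℝ => max x (1 / 2) + 1 + 1 / (4 * max x (1 / 2))) (Ici 0) ∧
    (∀ x y : ℝ, 0 ≤ x → x ≤ y →
      (max y (1 / 2) + 1 + 1 / (4 * max y (1 / 2))) - (max x (1 / 2) + 1 + 1 / (4 * max x (1 / 2))) ≤ y - x) ∧
    (∀ x : ℝ, 0 ≤ x → max 2 (x + 1) ≤ max x (1 / 2) + 1 + 1 / (4 * max x (1 / 2))) ∧
    (∀ x : ℝ, 0 ≤ x → max x (1 / 2) + 1 + 1 / (4 * max x (1 / 2)) ≤ x + 2) ∧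
    (∀ y : ℝ, 0 < y → (1 + y) * (max (2 / (1 + y)) (1 / 2) + 1 + 1 / (4 * max (2 / (1 + y)) (1 / 2))) ≤
      2 * (max y (1 / 2) + 1 + 1 / (4 * max y (1 / 2)))) := by
  refine ⟨?_, ?_, ?_, ?_, ?_, ?_⟩
  · -- convexity: a convex monotone function of the convex `max x ½`
    have hm : ConvexOn ℝ (Ici (0 : ℝ)) (fun x : ℝ => max x (1 / 2)) :=
      (convexOn_id (convex_Ici (0 : ℝ))).sup (convexOn_const _ (convex_Ici (0 : ℝ)))
    have hg : ConvexOn ℝ ((fun x : ℝ => max x (1 / 2)) '' Ici (0 : ℝ)) (fun t : ℝ => t + 1 + 1 / (4 * t)) := by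
      rw [image_max_half]; exact harmonic_convexOn
    have hg' : MonotoneOn (fun t : ℝ => t + 1 + 1 / (4 * t)) ((fun x : ℝ => max x (1 / 2)) '' Ici (0 : ℝ)) := by
      rw [image_max_half]
      intro s (hs : 1 / 2 ≤ s) t _ hst
      have := (harmonic_incr hs hst).1
      show s + 1 + 1 / (4 * s) ≤ t + 1 + 1 / (4 * t)
      linarith
    exact hg.comp hm hg'
  · intro x _ y _ hxy
    have := (harmonic_incr (le_max_right x (1 / 2)) (max_le_max hxy le_rfl)).1
    show max x (1 / 2) + 1 + 1 / (4 * max x (1 / 2)) ≤ max y (1 / 2) + 1 + 1 / (4 * max y (1 / 2))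
    linarith
  · intro x y hx hxy
    have h1 := (harmonic_incr (le_max_right x (1 / 2)) (max_le_max hxy le_rfl)).2
    have h2 : max y (1 / 2) - max x (1 / 2) ≤ y - x := by
      rcases le_total y (1 / 2) with hy | hy
      · rw [max_eq_right hy, max_eq_right (hxy.trans hy)]; linarith
      · rw [max_eq_left hy]
        have := le_max_left x (1 / 2)
        linarith
    linarith
  · intro x _
    have hf := harmonic_floor (lt_of_lt_of_le (by norm_num) (le_max_right x (1 / 2)))
    have hx := le_max_left x (1 / 2)
    exact max_le hf.1 (by linarith [hf.2])
  · intro x hx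
    rcases le_total x (1 / 2) with h | h
    · rw [max_eq_right h]; norm_num; linarith
    · rw [max_eq_left h]
      have : 1 / (4 * x) ≤ 1 := by rw [div_le_one (by linarith)]; linarith
      linarith
  · intro y hy
    have hy1 : (0 : ℝ) < 1 + y := by linarith
    rcases lt_or_ge y (1 / 2) with hlt | hge
    · -- `y < ½`: `f(y) = 2`, `z = 2/(1+y) > 4/3`
      have hz : (1 / 2 : ℝ) ≤ 2 / (1 + y) := by rw [le_div_iff₀ hy1]; linarith
      rw [max_eq_right hlt.le, max_eq_left hz]
      have key : 2 * ((1 / 2 : ℝ) + 1 + 1 / (4 * (1 / 2))) -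
          (1 + y) * (2 / (1 + y) + 1 + 1 / (4 * (2 / (1 + y)))) = (16 - 8 * (1 + y) - (1 + y) ^ 2) / 8 := by
        field_simp; ring
      have : 0 ≤ (16 - 8 * (1 + y) - (1 + y) ^ 2) / 8 := by
        apply div_nonneg _ (by norm_num); nlinarith
      linarith
    · rw [max_eq_left hge]
      rcases le_or_gt y 3 with hle | hgt
      · -- `½ ≤ y ≤ 3`: both curved; the fold is `(y−1)²(y−4) ≤ 0`
        have hz : (1 / 2 : ℝ) ≤ 2 / (1 + y) := by rw [le_div_iff₀ hy1]; linarith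
        rw [max_eq_left hz]
        have key : 2 * (y + 1 + 1 / (4 * y)) - (1 + y) * (2 / (1 + y) + 1 + 1 / (4 * (2 / (1 + y)))) =
            -((y - 1) ^ 2 * (y - 4)) / (8 * y) := by
          field_simp; ring
        have : 0 ≤ -((y - 1) ^ 2 * (y - 4)) / (8 * y) :=
          div_nonneg (by nlinarith [sq_nonneg (y - 1)]) (by linarith)
        linarith
      · -- `y > 3`: `z < ½`, `f(z) = 2`
        have hz : 2 / (1 + y) ≤ (1 / 2 : ℝ) := by rw [div_le_iff₀ hy1]; linarith
        rw [max_eq_right hz, show (1 / 2 : ℝ) + 1 + 1 / (4 * (1 / 2)) = 2 by norm_num]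
        have : 0 < 1 / (4 * y) := by positivity
        nlinarith

/-! ## §2 The harmonic world -/

/-- **THE HARMONIC WORLD.**  A functional `W` with ALL the 3D laws (symmetric, positively homogeneous,
subadditive, monotone in the middle argument, sandwiched) whose pencil is the harmonic profile: plateau
`W(1,x,1) = 2` on `(0,½]`, `W(1,x,1) = x + 1 + 1/(4x)` on `[½,∞)`, `W(1,1,1) = 9/4`; NO saturated length
(`x + 1 < W(1,x,1)` for every `x > 0`, so `FiniteSaturation`-shape fails); the anchored law `L_W(a)` for EVERY
`a ≥ ½` (in particular every `a ∈ [½,1)` and `a = 1`) and its failure for every `0 < a < ½`; and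
`RealLogConvexity`-shape. -/
theorem harmonicWorld :
    ∃ W : ℝ → ℝ → ℝ → ℝ,
      ((∀ x y z : ℝ, W x y z = W y x z ∧ W x y z = W x z y) ∧
        (∀ ν : ℝ, 0 < ν → ∀ x y z : ℝ, 0 < x → 0 < y → 0 < z →
          W (ν * x) (ν * y) (ν * z) = ν * W x y z) ∧
        (∀ x y z x' y' z' : ℝ, 0 < x → 0 < y → 0 < z → 0 < x' → 0 < y' → 0 < z' →
          W (x + x') (y + y') (z + z') ≤ W x y z + W x' y' z') ∧
        (∀ x y y' z : ℝ, 0 < x → 0 < y → y ≤ y' → 0 < z → W x y z ≤ W x y' z) ∧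
        (∀ x y z : ℝ, 0 < x → 0 < y → 0 < z →
          max (x + z) (max (x + y) (y + z)) ≤ W x y z ∧ W x y z ≤ x + y + z)) ∧
      (∀ x : ℝ, 0 < x → x ≤ 1 / 2 → W 1 x 1 = 2) ∧
      (∀ x : ℝ, 1 / 2 ≤ x → W 1 x 1 = x + 1 + 1 / (4 * x)) ∧
      W 1 1 1 = 9 / 4 ∧
      (∀ x : ℝ, 0 < x → x + 1 < W 1 x 1) ∧
      (∀ a : ℝ, 1 / 2 ≤ a → ∀ m : ℝ, a < m →
        (W 1 m 1 - (m + 1)) ^ 2 ≤ (W 1 a 1 - (a + 1)) * (W 1 (2 * m - a) 1 - (2 * m - a + 1))) ∧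
      (∀ a : ℝ, 0 < a → a < 1 / 2 → ¬ ∀ m : ℝ, a < m →
        (W 1 m 1 - (m + 1)) ^ 2 ≤ (W 1 a 1 - (a + 1)) * (W 1 (2 * m - a) 1 - (2 * m - a + 1))) ∧
      (∀ k h : ℝ, 0 < h → 1 ≤ k - h →
        (W 1 k 1 - (k + 1)) ^ 2 ≤ (W 1 (k - h) 1 - (k - h + 1)) * (W 1 (k + h) 1 - (k + h + 1))) := by
  obtain ⟨hconv, hmono, hlip, hlow, hup, hfold⟩ := harmonic_admissible
  let f : ℝ → ℝ := fun x => max x (1 / 2) + 1 + 1 / (4 * max x (1 / 2))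
  let W : ℝ → ℝ → ℝ → ℝ := fun a b c => max ((a + c) / 2 * f (2 * b / (a + c)))
    (max ((a + b) / 2 * f (2 * c / (a + b))) ((b + c) / 2 * f (2 * a / (b + c))))
  have hW : ∀ a b c : ℝ, W a b c = max ((a + c) / 2 * f (2 * b / (a + c)))
      (max ((a + b) / 2 * f (2 * c / (a + b))) ((b + c) / 2 * f (2 * a / (b + c)))) := fun _ _ _ => rfl
  obtain ⟨hsym, hhom, hsub, hmon, hsand, hpen⟩ := perspectiveWorld_realises hW hconv hmono hlip hlow hup hfold
  -- the pencil, explicitly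
  have hplat : ∀ x : ℝ, 0 < x → x ≤ 1 / 2 → W 1 x 1 = 2 := by
    intro x hx hxh
    rw [hpen x hx]
    show max x (1 / 2) + 1 + 1 / (4 * max x (1 / 2)) = 2
    rw [max_eq_right hxh]; norm_num
  have hcurv : ∀ x : ℝ, 1 / 2 ≤ x → W 1 x 1 = x + 1 + 1 / (4 * x) := by
    intro x hx
    rw [hpen x (by linarith)]
    show max x (1 / 2) + 1 + 1 / (4 * max x (1 / 2)) = x + 1 + 1 / (4 * x)
    rw [max_eq_left hx]
  have hexc : ∀ x : ℝ, 1 / 2 ≤ x → W 1 x 1 - (x + 1) = 1 / (4 * x) := fun x hx => by rw [hcurv x hx]; ring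
  refine ⟨W, ⟨hsym, hhom, hsub, hmon, hsand⟩, hplat, hcurv, ?_, ?_, ?_, ?_, ?_⟩
  · rw [hcurv 1 (by norm_num)]; norm_num
  · intro x hx
    rcases le_or_gt x (1 / 2) with h | h
    · rw [hplat x hx h]; linarith
    · rw [hcurv x h.le]
      have : 0 < 1 / (4 * x) := by positivity
      linarith
  · intro a ha m hm
    rw [hexc a ha, hexc m (by linarith), hexc (2 * m - a) (by linarith), div_pow, one_pow,
      one_div_mul_one_div, one_div_le_one_div (pow_pos (by linarith) 2) (mul_pos (by linarith) (by linarith))]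
    nlinarith [sq_nonneg (m - a)]
  · intro a ha0 ha hL
    -- three plateau points `a < m = a/2 + 1/4 < 2m − a = 1/2`: `(1−m)² > (1−a)·½`
    have hm := hL (a / 2 + 1 / 4) (by linarith)
    rw [hplat a ha0 ha.le, hplat (a / 2 + 1 / 4) (by linarith) (by linarith),
      show 2 * (a / 2 + 1 / 4) - a = 1 / 2 by ring, hplat (1 / 2) (by norm_num) le_rfl] at hm
    nlinarith [sq_nonneg (2 * a - 1), (show 0 < (2 * a - 1) ^ 2 from by
      have : 2 * a - 1 ≠ 0 := by intro h; apply ha.ne; linarith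
      positivity)]
  · intro k h hh hk
    rw [hexc k (by linarith), hexc (k - h) (by linarith), hexc (k + h) (by linarith), div_pow, one_pow,
      one_div_mul_one_div, one_div_le_one_div (pow_pos (by linarith) 2) (mul_pos (by linarith) (by linarith))]
    nlinarith [sq_nonneg h]

/-! ## §3 Reading against the cut -/

/-- **Reading.**  There is a 3D-lawful `W` in which `AnchoredLogConvexity`-shape holds (anchor `1`), EVERY
sub-square anchored law `L_W(a)` with `½ ≤ a < 1` holds, `FiniteSaturation`-shape FAILS, and `W(1,1,1) = 9/4 > 2`:
so (i) the generic leaf — even the whole anchored family from the plateau edge on — does not give `ω = 2` among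
the shape laws, and (ii) the special-leaf hypothesis of
`FarEdgeDescentAnchorLaw.not_anchoredLaw_of_finiteSaturation` is load-bearing: the laws alone refute no anchor at
or above the plateau edge. -/
theorem harmonicWorld_reading :
    ∃ W : ℝ → ℝ → ℝ → ℝ,
      ((∀ x y z : ℝ, W x y z = W y x z ∧ W x y z = W x z y) ∧
        (∀ ν : ℝ, 0 < ν → ∀ x y z : ℝ, 0 < x → 0 < y → 0 < z →
          W (ν * x) (ν * y) (ν * z) = ν * W x y z) ∧
        (∀ x y z x' y' z' : ℝ, 0 < x → 0 < y → 0 < z → 0 < x' → 0 < y' → 0 < z' →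
          W (x + x') (y + y') (z + z') ≤ W x y z + W x' y' z') ∧
        (∀ x y y' z : ℝ, 0 < x → 0 < y → y ≤ y' → 0 < z → W x y z ≤ W x y' z) ∧
        (∀ x y z : ℝ, 0 < x → 0 < y → 0 < z →
          max (x + z) (max (x + y) (y + z)) ≤ W x y z ∧ W x y z ≤ x + y + z)) ∧
      (∀ m : ℝ, 1 < m → (W 1 m 1 - (m + 1)) ^ 2 ≤ (W 1 1 1 - 2) * (W 1 (2 * m - 1) 1 - 2 * m)) ∧
      (∀ a : ℝ, 1 / 2 ≤ a → a < 1 → ∀ m : ℝ, a < m →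
        (W 1 m 1 - (m + 1)) ^ 2 ≤ (W 1 a 1 - (a + 1)) * (W 1 (2 * m - a) 1 - (2 * m - a + 1))) ∧
      (¬ ∃ K : ℕ, 2 ≤ K ∧ W 1 K 1 = K + 1) ∧
      W 1 1 1 = 9 / 4 := by
  obtain ⟨W, hlaws, -, -, hone, hstrict, hL, -, -⟩ := harmonicWorld
  refine ⟨W, hlaws, fun m hm => ?_, fun a ha _ => hL a ha, ?_, hone⟩
  · have h := hL 1 (by norm_num) m hm
    rw [show ((1 : ℝ) + 1) = 2 by norm_num, show 2 * m - 1 + 1 = 2 * m by ring] at h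
    exact h
  · rintro ⟨K, hK, hsat⟩
    have h2 : (0 : ℝ) < K := by exact_mod_cast (by omega : 0 < K)
    have := hstrict K h2
    linarith

end Summit.MatrixMultiplication.MatrixMultiplication.Theorems.FarEdgeDescentHarmonicWorld

end
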